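import Summits.KontsevichZagierPeriods.KontsevichZagierPeriods.Theses.RootDecompRationalCubeDichotomy
import Literature.NumberTheory.Transcendental.KZCubeRationalMoves

/-!
# Route RootDecompRationalCubeDichotomy — `SectorMerge` (item stmt-KontsevichZagierPeriods-26323)

THEOREM-type support of the gen-2 split of `RationalCubePiKernel` (24905): every element of the
subgroup generated by rational closed-unit-cube representations (`[cube, P/Q]`, `Q` zero-free on the
closed cube) is congruent modulo `KZ.relations` to ONE such representation.

Proof (= `sectorMerge_holds` of the decomp-kz lens-2 node file
`run/shared/lean/pub/decomp-kz/decomp-kz-lens-2/g3/RationalCubeDichotomy.lean`, gen 3, where it is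
kernel-checked against a verbatim vendored copy of the kit): closure induction on the landed
rational-cube move kit `Literature.NumberTheory.Transcendental.KZ.RFun`
(`KZCubeRational`, `KZCubeRationalMoves`): a literal generator is congruent to `(⟨P, Q⟩ : RFun m).rep`
(`KZ.of_sub_of_mem_relations_of_eqOn`); `0 ↦ (RFun.const 0 : RFun 0)` (`rel_of_eqOn_zero`);
`x + y ↦ (T.liftN n).add ((S.liftN m).rename (finCongr (Nat.add_comm n m)))`
(`rel_liftN`, `rel_rename`, `rel_add`); `-x ↦ T.neg` (`rel_neg`). Standard axioms.

FARM NOTE: needs `Literature.NumberTheory.Transcendental.KZCubeRationalMoves` built (unbuilt on the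
snapshot of 2026-08-30 03:00Z: `lean check` rc 75 `remote:stale:unbuilt`). Propose when it builds.
-/

namespace Summit.KontsevichZagierPeriods.RootDecompRationalCubeDichotomy

open MvPolynomial
open Literature.NumberTheory.Transcendental Literature.NumberTheory.Transcendental.KZ

/-- The rational closed-unit-cube sector, literally as in the route items. -/
def ratCubeSet : Set FormalRep :=
  {x : FormalRep | ∃ (m : ℕ) (q : IntegralRep m) (P Q : MvPolynomial (Fin m) ℚ),
    q.domain = Set.pi Set.univ (fun _ : Fin m => Set.Icc (0:ℝ) 1) ∧
    (∀ z ∈ Set.pi Set.univ (fun _ : Fin m => Set.Icc (0:ℝ) 1), aeval z Q ≠ 0) ∧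
    (∀ z ∈ Set.pi Set.univ (fun _ : Fin m => Set.Icc (0:ℝ) 1), q.integrand z = aeval z P / aeval z Q) ∧
    x = of q}

/-- The literal cube of the items is `KZ.cube`. -/
theorem cubeLit_eq_cube (m : ℕ) :
    (Set.pi Set.univ fun _ : Fin m => Set.Icc (0:ℝ) 1) = KZ.cube m := by
  ext z
  simp only [Set.mem_pi, Set.mem_univ, forall_const, Set.mem_Icc, KZ.mem_cube]

/-- The cube representation of a regular rational function lies in the sector. -/
theorem rfun_rep_mem_ratCubeSet {m : ℕ} (T : RFun m) : of T.rep ∈ ratCubeSet := by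
  refine ⟨m, T.rep, T.num, T.den, ?_, fun z hz => T.den_ne z ?_, fun z _ => ?_, rfl⟩
  · rw [RFun.rep_domain, cubeLit_eq_cube]
  · rw [← cubeLit_eq_cube]; exact hz
  · rw [RFun.rep_integrand, RFun.fn_apply]

/-- A literal generator is congruent modulo relations to the cube representation of `⟨P, Q⟩`. -/
theorem exists_rfun_of_mem_ratCubeSet {y : FormalRep} (hy : y ∈ ratCubeSet) :
    ∃ (m : ℕ) (T : RFun m), y - of T.rep ∈ relations := by
  obtain ⟨m, q, P, Q, hdom, hQ, hint, rfl⟩ := hy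
  have hQ' : ∀ x ∈ KZ.cube m, aeval x Q ≠ 0 := fun x hx => hQ x (by rw [cubeLit_eq_cube]; exact hx)
  refine ⟨m, ⟨P, Q, hQ'⟩, KZ.of_sub_of_mem_relations_of_eqOn ?_ fun x hx => ?_⟩
  · rw [RFun.rep_domain, hdom, cubeLit_eq_cube]
  · have hx' : x ∈ Set.pi Set.univ (fun _ : Fin m => Set.Icc (0:ℝ) 1) := by rw [← hdom]; exact hx
    rw [RFun.rep_integrand, RFun.fn_apply]
    exact hint x hx'

/-- Closure induction: every element of the generated subgroup is congruent to ONE `RFun` representation. -/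
theorem exists_rfun_of_mem_closure {y : FormalRep} (hy : y ∈ AddSubgroup.closure ratCubeSet) :
    ∃ (m : ℕ) (T : RFun m), y - of T.rep ∈ relations := by
  induction hy using AddSubgroup.closure_induction with
  | mem x hx => exact exists_rfun_of_mem_ratCubeSet hx
  | zero =>
    refine ⟨0, RFun.const 0, ?_⟩
    rw [zero_sub]
    exact relations.neg_mem (RFun.rel_of_eqOn_zero (T := (RFun.const 0 : RFun 0)) fun x _ => by simp)
  | add x y _ _ hx hy =>
    obtain ⟨m, T, hT⟩ := hx
    obtain ⟨n, S, hS⟩ := hy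
    have h1 : of (T.liftN n).rep - of T.rep ∈ relations := RFun.rel_liftN T n
    have h2 : of ((S.liftN m).rename (finCongr (Nat.add_comm n m))).rep - of S.rep ∈ relations := by
      have a : of (S.liftN m).rep - of S.rep ∈ relations := RFun.rel_liftN S m
      have b := RFun.rel_rename (S.liftN m) (finCongr (Nat.add_comm n m))
      have e : of ((S.liftN m).rename (finCongr (Nat.add_comm n m))).rep - of S.rep =
          (of (S.liftN m).rep - of S.rep) -
            (of (S.liftN m).rep - of ((S.liftN m).rename (finCongr (Nat.add_comm n m))).rep) := by abel
      rw [e]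
      exact relations.sub_mem a b
    have h3 := RFun.rel_add (T.liftN n) ((S.liftN m).rename (finCongr (Nat.add_comm n m)))
    refine ⟨m + n, (T.liftN n).add ((S.liftN m).rename (finCongr (Nat.add_comm n m))), ?_⟩
    have e : x + y - of ((T.liftN n).add ((S.liftN m).rename (finCongr (Nat.add_comm n m)))).rep =
        (x - of T.rep) + (y - of S.rep) - (of (T.liftN n).rep - of T.rep)
          - (of ((S.liftN m).rename (finCongr (Nat.add_comm n m))).rep - of S.rep)
          - (of ((T.liftN n).add ((S.liftN m).rename (finCongr (Nat.add_comm n m)))).rep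
              - of (T.liftN n).rep - of ((S.liftN m).rename (finCongr (Nat.add_comm n m))).rep) := by abel
    rw [e]
    exact relations.sub_mem (relations.sub_mem (relations.sub_mem (relations.add_mem hT hS) h1) h2) h3
  | neg x _ hx =>
    obtain ⟨m, T, hT⟩ := hx
    refine ⟨m, T.neg, ?_⟩
    have h := RFun.rel_neg T
    have e : -x - of T.neg.rep = -(x - of T.rep) - (of T.neg.rep + of T.rep) := by abel
    rw [e]
    exact relations.sub_mem (relations.neg_mem hT) h

/-- **SectorMerge** (item stmt-KontsevichZagierPeriods-26323) holds. -/
theorem sectorMerge_proof :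
    Summit.KontsevichZagierPeriods.KontsevichZagierPeriods.Theses.RootDecompRationalCubeDichotomy.SectorMerge := by
  intro y hy
  obtain ⟨m, T, hT⟩ := exists_rfun_of_mem_closure hy
  obtain ⟨m', q, P, Q, hdom, hQ, hint, hq⟩ := rfun_rep_mem_ratCubeSet T
  exact ⟨m', q, P, Q, hdom, hQ, hint, by rw [← hq]; exact hT⟩

end Summit.KontsevichZagierPeriods.RootDecompRationalCubeDichotomy
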